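import Summits.Ventures.DiscreteObjects.Hadamard.Order668Excluded
import Summits.Ventures.DiscreteObjects.Hadamard.InvolutionDet

/-!
# Hadamard 668 census, family F12 — the EVEN side of the order table in one statement (kernel summary)

Framing: lottery ticket; floor = certified bounds/negative ranges.

Cell pub-namedobj (venture DiscreteObjects), target (H), hadamard gen 12.  One quotable theorem collecting the gen-12 kernel results on
signed-permutation automorphisms `(π, κ, d, e)` of a Hadamard matrix of order `668` (`IsHadamardMatrix H`, `Fintype.card ι = 668`,
`IsSignedAut H π κ d e`; `N = orderOf (π, κ)`):
**`hadamard668_signedAut_even_summary`** —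
1. `N ≠ 668` (EXCLUSION: order `668` would make `H` negacyclic, `Order668Excluded` + `NegacyclicObstruction`);
2. `167 ∣ N ⇒ N ∈ {167, 334}` (`OrderDvd167`);
3. `N = 334 ⇒` `π^167`, `κ^167` fixed-point-free and every cycle sign product `∏_{k<334} d (π^k i) = −1 = ∏_{k<334} e (κ^k j)`
   (STRUCTURE: two-negacirculant / Williamson–Ito type; `Order334Orbits`, `Order334Nega`);
4. `N = 2 ⇒` `π ≠ 1`, `κ ≠ 1` and the involution census: type I (`#Fix π = #Fix κ = f`, `4 ∣ f`, `4 ≤ f ≤ 332`, one common fixed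
   sign), type II (`{#Fix π, #Fix κ} = {0, 4}`, fixed signs summing to `0`) or type III (no fixed row or column)
   (`InvolutionCensus668`, `InvolutionDet`).
Nothing new is proved here.  Ours; no `sorry`.
-/

namespace Summit.Ventures.DiscreteObjects.Hadamard

open Finset BigOperators Matrix

open Literature.Combinatorics.Designs.GoethalsSeidel (IsHadamardMatrix)

variable {ι : Type*} [Fintype ι] [DecidableEq ι]

variable {H : Matrix ι ι ℤ}

/-- **The even side of the order table for Aut(H(668)), kernel summary** (see the module docstring). -/
theorem hadamard668_signedAut_even_summary (hH : IsHadamardMatrix H) (hι : Fintype.card ι = 668)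
    (π κ : Equiv.Perm ι) (d e : ι → ℤ) (haut : IsSignedAut H π κ d e) :
    orderOf ((π, κ) : Equiv.Perm ι × Equiv.Perm ι) ≠ 668 ∧
    (167 ∣ orderOf ((π, κ) : Equiv.Perm ι × Equiv.Perm ι) →
      orderOf ((π, κ) : Equiv.Perm ι × Equiv.Perm ι) = 167 ∨ orderOf ((π, κ) : Equiv.Perm ι × Equiv.Perm ι) = 334) ∧
    (orderOf ((π, κ) : Equiv.Perm ι × Equiv.Perm ι) = 334 →
      ((∀ i, (π ^ 167) i ≠ i) ∧ (∀ j, (κ ^ 167) j ≠ j)) ∧ (∀ i, cyc π d i 334 = -1) ∧ (∀ j, cyc κ e j 334 = -1)) ∧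
    (orderOf ((π, κ) : Equiv.Perm ι × Equiv.Perm ι) = 2 →
      π ≠ 1 ∧ κ ≠ 1 ∧
      (((univ.filter fun i => π i = i).card = (univ.filter fun j => κ j = j).card ∧
          4 ∣ (univ.filter fun i => π i = i).card ∧ 4 ≤ (univ.filter fun i => π i = i).card ∧
          (univ.filter fun i => π i = i).card ≤ 332 ∧
          ∃ δ : ℤ, (δ = 1 ∨ δ = -1) ∧ (∀ i, π i = i → d i = δ) ∧ (∀ j, κ j = j → e j = δ)) ∨
       ((univ.filter fun i => π i = i).card = 0 ∧ (univ.filter fun j => κ j = j).card = 4 ∧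
          ∑ j ∈ univ.filter (fun j => κ j = j), e j = 0) ∨
       ((univ.filter fun i => π i = i).card = 4 ∧ (univ.filter fun j => κ j = j).card = 0 ∧
          ∑ i ∈ univ.filter (fun i => π i = i), d i = 0) ∨
       ((univ.filter fun i => π i = i).card = 0 ∧ (univ.filter fun j => κ j = j).card = 0))) := by
  refine ⟨hadamard668_signedAut_orderOf_ne_668 hH hι π κ d e haut,
    hadamard668_signedAut_orderOf_of_167_dvd' hH hι π κ d e haut,
    hadamard668_signedAut_orderOf_334 hH hι π κ d e haut, fun hord => ?_⟩
  obtain ⟨hπ1, hκ1, hcases⟩ := hadamard668_signedAut_orderOf_2 hH hι π κ d e haut hord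
  refine ⟨hπ1, hκ1, ?_⟩
  obtain ⟨hπ, hκ, hne⟩ := pow_data_of_orderOf hord (a := 1) (by norm_num) (by norm_num)
  rw [pow_one, pow_one] at hne
  rcases hcases with ⟨h1, -, h3, h4, h5⟩ | h | h | h
  · left
    -- type I: sharpen `2 ∣ f` to `4 ∣ f` by the determinant refinement
    have hr : ∃ i, π i = i := by
      by_contra hno
      have : (univ.filter fun i => π i = i).card = 0 := by
        rw [Finset.card_eq_zero, Finset.filter_eq_empty_iff]; intro i _ hi; exact hno ⟨i, hi⟩
      omega
    have hc : ∃ j, κ j = j := by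
      by_contra hno
      have : (univ.filter fun j => κ j = j).card = 0 := by
        rw [Finset.card_eq_zero, Finset.filter_eq_empty_iff]; intro j _ hj; exact hno ⟨j, hj⟩
      omega
    obtain ⟨h4dvd, h4le, h332, _⟩ := hadamard668_involution_typeI_mod4 hH hι π κ d e haut hπ hκ hne hr hc
    exact ⟨h1, h4dvd, h4le, h332, h5⟩
  · exact Or.inr (Or.inl h)
  · exact Or.inr (Or.inr (Or.inl h))
  · exact Or.inr (Or.inr (Or.inr h))

end Summit.Ventures.DiscreteObjects.Hadamard
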